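import Summits.Parity.BatemanHorn.Theorems.AlmostPrimeZerosSystemZeroRepulsionApCharBoundNonprincipal
import Summits.Parity.BatemanHorn.Theorems.AlmostPrimeZerosSystemZeroRepulsionApTiltedReindex

/-!
# The AP tilted majorant, IV: assembly (stub `stub_apTiltedAssembly`)
(crux stmt-Parity-11291, line `smooth-rough-lattice-acquisition`, class `linₐ`, lead c2)

Everything here is PROVED (theorems only).  **The one-sided Selberg–Delange majorant in an
arithmetic progression** `‖Σ_{0≤n≤x} z^{s((an+b)⁺)}‖ ≤ (x + 1)·exp(log log x·(Re z − 1) + A(1 + ‖z − 1‖)^{3/2})`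
(`a ≥ 2`, `(a, b) = 1`, `x ≥ x₀`, `‖z − 1‖ ≤ log log x / C`) from the statements of the registered
stubs A (`stub_apTwistedEulerData`), C (`stub_apLogL`), D (`stub_apHolRieszBound`): reindex to the
progression (`stub_apTiltedReindex`, boundary terms `≪_b R^{2|b|+2}`), orthogonality
(`DirichletCharacter.sum_char_inv_mul_char_eq`), the character bounds `stub_apCharBoundPrincipal` /
`stub_apCharBoundNonprincipal`, and `(log y)^{Re z−1} ≤ (log x)^{Re z−1} e^{‖z−1‖ log(a+|b|)}` for
`y = ax + b ≤ (a+|b|)x`.  References: Montgomery–Vaughan, *Multiplicative Number Theory I*, §7.4, §11.3.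
-/

noncomputable section

namespace Summit.Parity.BatemanHorn.Cruxes.SystemZeroRepulsion.NearFar

open scoped BigOperators
open Literature.NumberTheory.LFunctions

/-! ### The assembly -/

/-- **The one-sided Selberg–Delange majorant in an arithmetic progression** (registered stub E
`stub_apTiltedAssembly`): the statements of stubs A, C, D imply, for `a ≥ 2`, `(a, b) = 1`, the
existence of `A ≥ 0`, `C > 0`, `x₀` with
`‖Σ_{0≤n≤x} z^{s((an+b)⁺)}‖ ≤ (x+1)·exp(log log x·(Re z − 1) + A(1 + ‖z − 1‖)^{3/2})` for all
`x ≥ x₀`, `‖z − 1‖ ≤ log log x / C`. -/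
theorem stub_apTiltedAssembly :
    (∀ (q : ℕ) [NeZero q] (χ : DirichletCharacter ℂ q), ∃ b : ℝ, 0 ≤ b ∧ ∀ R : ℝ, 0 ≤ R → ∀ z : ℂ, ‖z‖ ≤ R →
        ∃ G : ℂ → ℂ, DifferentiableOn ℂ G {s : ℂ | 1 / 2 < s.re} ∧
          (∀ s : ℂ, 4 / 5 < s.re → ‖G s‖ ≤ Real.exp (b * (1 + R) ^ (3 / 2 : ℝ))) ∧
          (∀ σ : ℝ, 1 < σ →
            LSeriesSummable (fun n : ℕ => χ (n : ZMod q) * z ^ (n.factorization.sum fun _ v => min v 2)) σ) ∧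
          (∀ s : ℂ, 1 < s.re →
            LSeries (fun n : ℕ => χ (n : ZMod q) * z ^ (n.factorization.sum fun _ v => min v 2)) s =
              Complex.exp (z * ∑' p : Nat.Primes, -Complex.log (1 - χ ((p : ℕ) : ZMod q) * ((p : ℕ) : ℂ) ^ (-s))) * G s) ∧
          (∀ σ : ℝ, 1 < σ → σ ≤ 2 →
            ∑' n : ℕ, ‖LSeries.term (fun n : ℕ => χ (n : ZMod q) * z ^ (n.factorization.sum fun _ v => min v 2)) σ n‖ ≤
              Real.exp (b * (1 + R) ^ (3 / 2 : ℝ)) / (σ - 1) ^ R) ∧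
          (χ = 1 → Literature.NumberTheory.LFunctions.SelbergDelange.RieszData R (4 / 5) (Real.exp (b * (1 + R) ^ (3 / 2 : ℝ))) z
            (fun n : ℕ => χ (n : ZMod q) * z ^ (n.factorization.sum fun _ v => min v 2))
            (fun s : ℂ => G s * Complex.exp (z * ∑ p ∈ q.primeFactors, Complex.log (1 - ((p : ℕ) : ℂ) ^ (-s)))))) →
    (∀ (q : ℕ) [NeZero q] (χ : DirichletCharacter ℂ q), χ ≠ 1 → ∃ c : ℝ, 0 < c ∧ ∃ C : ℝ, 0 ≤ C ∧ ∃ ℓ : ℂ → ℂ,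
        DifferentiableOn ℂ ℓ (Literature.NumberTheory.LFunctions.ClassicalPsiData.zfr c) ∧
        (∀ s ∈ Literature.NumberTheory.LFunctions.ClassicalPsiData.zfr c, ‖ℓ s‖ ≤ Real.log (Real.log (|s.im| + 4)) + C) ∧
        (∀ s : ℂ, 1 < s.re →
          ℓ s = ∑' p : Nat.Primes, -Complex.log (1 - χ ((p : ℕ) : ZMod q) * ((p : ℕ) : ℂ) ^ (-s)))) →
    (∀ (c K : ℝ), 0 < c → 1 ≤ K → ∃ X₀ : ℝ, ∀ (R B : ℝ) (a : ℕ → ℂ) (F : ℂ → ℂ), 1 ≤ R → 0 ≤ B →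
        DifferentiableOn ℂ F (Literature.NumberTheory.LFunctions.ClassicalPsiData.zfr c) →
        (∀ s ∈ Literature.NumberTheory.LFunctions.ClassicalPsiData.zfr c, ‖F s‖ ≤ B * (K * Real.log (|s.im| + 4)) ^ R) →
        (∀ σ : ℝ, 1 < σ → LSeriesSummable a σ) →
        (∀ s : ℂ, 1 < s.re → LSeries a s = F s) →
        (∀ σ : ℝ, 1 < σ → σ ≤ 2 → ∑' n : ℕ, ‖LSeries.term a σ n‖ ≤ B / (σ - 1) ^ R) →
        ∀ x : ℝ, X₀ ≤ x → R ≤ Real.log (Real.log x) →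
          ‖∑ n ∈ Finset.Ioc 0 ⌊x⌋₊, a n * ((x : ℂ) - n)‖ ≤
            x ^ 2 * Real.log x ^ (-R) * Real.exp (-(Real.log (Real.log x)) ^ 3) * B) →
    ∀ (a b : ℤ), 2 ≤ a → IsCoprime a b → ∃ A : ℝ, 0 ≤ A ∧ ∃ C : ℝ, 0 < C ∧ ∃ x₀ : ℕ, ∀ x : ℕ, x₀ ≤ x → ∀ z : ℂ,
      ‖z - 1‖ ≤ Real.log (Real.log x) / C →
      ‖∑ n ∈ Finset.range (x + 1), z ^ (((a * (n : ℤ) + b).toNat).factorization.sum fun _ v => min v 2)‖ ≤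
        ((x : ℝ) + 1) * Real.exp (Real.log (Real.log x) * (z.re - 1) + A * (1 + ‖z - 1‖) ^ (3 / 2 : ℝ)) := by
  intro hA hC hD a b ha hcop
  -- the modulus `q = a` and the unit `β = b mod q`
  set q : ℕ := a.toNat with hqdef
  have hqa : (q : ℤ) = a := Int.toNat_of_nonneg (by omega)
  have hq2 : 2 ≤ q := by omega
  haveI : NeZero q := ⟨by omega⟩
  -- per-character bounds and uniform constants
  have hchar : ∀ χ : DirichletCharacter ℂ q, ∃ A : ℝ, 0 ≤ A ∧ ∃ C : ℝ, 0 < C ∧ ∃ y₀ : ℕ, ∀ y : ℕ, y₀ ≤ y →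
      ∀ z : ℂ, 1 + ‖z - 1‖ ≤ Real.log (Real.log y) / C →
      ‖∑ n ∈ Finset.Ioc 0 y, χ (n : ZMod q) * z ^ (n.factorization.sum fun _ v => min v 2)‖ ≤
        (y : ℝ) * Real.log y ^ (z.re - 1) * Real.exp (A * (1 + ‖z - 1‖) ^ (3 / 2 : ℝ)) := by
    intro χ
    by_cases hχ : χ = 1
    · subst hχ; exact stub_apCharBoundPrincipal hA q
    · exact stub_apCharBoundNonprincipal hA hC hD q χ hχ
  choose Aχ hAχ0 Cχ hCχ yχ hyχ using hchar
  clear hA hC hD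
  set β : ZMod q := ((b : ℤ) : ZMod q) with hβdef
  have hβ : IsUnit β := isUnit_intCast_zmod_of_isCoprime (by omega) hcop
  set A₁ : ℝ := ∑ χ, Aχ χ with hA₁def
  have hA₁ : ∀ χ, Aχ χ ≤ A₁ := fun χ =>
    Finset.single_le_sum (f := Aχ) (fun χ _ => hAχ0 χ) (Finset.mem_univ χ)
  have hA₁0 : 0 ≤ A₁ := Finset.sum_nonneg fun χ _ => hAχ0 χ
  set C₀ : ℝ := ∑ χ, Cχ χ with hC₀def
  have hC₀ : ∀ χ, Cχ χ ≤ C₀ := fun χ =>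
    Finset.single_le_sum (f := Cχ) (fun χ _ => (hCχ χ).le) (Finset.mem_univ χ)
  have hC₀pos : 0 < C₀ := (hCχ 1).trans_le (hC₀ 1)
  set Y : ℕ := ∑ χ, yχ χ with hYdef
  have hY : ∀ χ, yχ χ ≤ Y := fun χ =>
    Finset.single_le_sum (f := yχ) (fun χ _ => Nat.zero_le _) (Finset.mem_univ χ)
  -- the constants of the statement
  set κ : ℝ := (a : ℝ) + b.natAbs with hκdef
  have hκ2 : (2 : ℝ) ≤ κ := by
    have h1 : (2 : ℝ) ≤ (a : ℝ) := by exact_mod_cast ha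
    have h2 : (0 : ℝ) ≤ b.natAbs := Nat.cast_nonneg _
    rw [hκdef]; linarith only [h1, h2]
  have hκ1 : (1 : ℝ) ≤ κ := by linarith only [hκ2]
  set nχ : ℝ := (Fintype.card (DirichletCharacter ℂ q) : ℝ) with hnχ
  set K₀ : ℝ := 2 * (b.natAbs : ℝ) + 1 + nχ * κ with hK₀def
  have hK₀1 : 1 ≤ K₀ := by
    have h1 : (0 : ℝ) ≤ 2 * (b.natAbs : ℝ) := by positivity
    have h2 : (0 : ℝ) ≤ nχ * κ := by positivity
    rw [hK₀def]; linarith only [h1, h2]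
  set A : ℝ := A₁ + Real.log κ + (2 * b.natAbs + 2) + K₀ with hAdef
  have hlogκ : 0 ≤ Real.log κ := Real.log_nonneg hκ1
  have hA0 : 0 ≤ A := by rw [hAdef]; positivity
  set C : ℝ := 2 * max C₀ 1 with hCdef
  have hC2 : (2 : ℝ) ≤ C := by rw [hCdef]; linarith only [le_max_right C₀ 1]
  have hCC₀ : 2 * C₀ ≤ C := by rw [hCdef]; linarith only [le_max_left C₀ 1]
  have hC : 0 < C := by linarith only [hC2]
  set x₀ : ℕ := max (max Y (b.natAbs + 1)) ⌈Real.exp (Real.exp C)⌉₊ with hx₀def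
  refine ⟨A, hA0, C, hC, x₀, fun x hx z hz => ?_⟩
  -- unpacking the threshold
  have hxY : Y ≤ x := le_trans ((le_max_left _ _).trans (le_max_left _ _)) hx
  have hxb : b.natAbs + 1 ≤ x := le_trans ((le_max_right _ _).trans (le_max_left _ _)) hx
  have hxexp : Real.exp (Real.exp C) ≤ (x : ℝ) :=
    (Nat.le_ceil _).trans (by exact_mod_cast (le_max_right _ _).trans hx)
  have hxpos : (0 : ℝ) < x := (Real.exp_pos _).trans_le hxexp
  have hx1 : (1 : ℝ) ≤ x := by exact_mod_cast (show 1 ≤ x by omega)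
  have hlogx : Real.exp C ≤ Real.log x := (Real.le_log_iff_exp_le hxpos).2 hxexp
  set 𝓛 : ℝ := Real.log x with h𝓛def
  have h𝓛pos : 0 < 𝓛 := (Real.exp_pos _).trans_le hlogx
  have h𝓛1 : 1 ≤ 𝓛 := by have := Real.add_one_le_exp C; linarith only [this, hlogx, hC]
  set L : ℝ := Real.log 𝓛 with hLdef
  have hCL : C ≤ L := (Real.le_log_iff_exp_le h𝓛pos).2 hlogx
  have hL2 : 2 ≤ L := hC2.trans hCL
  have hL0 : 0 < L := by linarith only [hL2]
  -- the radius
  set r : ℝ := ‖z - 1‖ with hrdef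
  have hr0 : 0 ≤ r := norm_nonneg _
  set R : ℝ := 1 + r with hRdef
  have hR1 : 1 ≤ R := by rw [hRdef]; linarith only [hr0]
  have hR0 : 0 ≤ R := by linarith only [hR1]
  have hrR : r ≤ R := by rw [hRdef]; linarith only []
  have hzR : ‖z‖ ≤ R := by
    have h := norm_add_le (z - 1) 1
    simp only [sub_add_cancel, norm_one] at h
    rw [hRdef, hrdef]; linarith only [h]
  have hrLC : r ≤ L / C := hz
  have hrL2 : r ≤ L / 2 := hrLC.trans (div_le_div_of_nonneg_left hL0.le (by norm_num) hC2)
  have hrez' : -r ≤ z.re - 1 := by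
    have h1 : |(z - 1).re| ≤ ‖z - 1‖ := Complex.abs_re_le_norm _
    have h2 : (z - 1).re = z.re - 1 := by simp
    rw [h2] at h1
    rw [hrdef]
    linarith only [neg_abs_le (z.re - 1), h1]
  have hrez : z.re - 1 ≤ r := by
    have h1 : |(z - 1).re| ≤ ‖z - 1‖ := Complex.abs_re_le_norm _
    have h2 : (z - 1).re = z.re - 1 := by simp
    rw [h2] at h1
    rw [hrdef]
    linarith only [le_abs_self (z.re - 1), h1]
  -- the length `y = ax + b` of the progression
  have haxb : 0 < a * (x : ℤ) + b := by
    have h1 : (b.natAbs : ℤ) + 1 ≤ x := by exact_mod_cast hxb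
    have h2 : -b ≤ (b.natAbs : ℤ) := by rw [Int.natCast_natAbs]; exact neg_le_abs b
    have h3 : 2 * (x : ℤ) ≤ a * x := mul_le_mul_of_nonneg_right ha (by positivity)
    linarith only [h1, h2, h3]
  set y : ℕ := (a * (x : ℤ) + b).toNat with hydef
  have hyZ : (y : ℤ) = a * x + b := Int.toNat_of_nonneg haxb.le
  have hyR : (y : ℝ) = a * x + b := by exact_mod_cast hyZ
  have hxy : (x : ℝ) ≤ y := by
    have h1 : (b.natAbs : ℝ) + 1 ≤ x := by exact_mod_cast hxb
    have h2 : -(b : ℝ) ≤ (b.natAbs : ℝ) := by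
      rw [Nat.cast_natAbs]; push_cast; exact neg_le_abs _
    have h3 : (2 : ℝ) ≤ (a : ℝ) := by exact_mod_cast ha
    have h4 : 2 * (x : ℝ) ≤ a * x := mul_le_mul_of_nonneg_right h3 hxpos.le
    rw [hyR]; linarith only [h1, h2, h4]
  have hyκ : (y : ℝ) ≤ κ * x := by
    have h2 : (b : ℝ) ≤ (b.natAbs : ℝ) := by
      rw [Nat.cast_natAbs]; push_cast; exact le_abs_self _
    have h3 : (b.natAbs : ℝ) ≤ b.natAbs * x := le_mul_of_one_le_right (Nat.cast_nonneg _) hx1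
    rw [hyR, hκdef]
    have e : ((a : ℝ) + b.natAbs) * x = a * x + b.natAbs * x := by ring
    rw [e]; linarith only [h2, h3]
  have hxyN : x ≤ y := by exact_mod_cast hxy
  have hypos : (0 : ℝ) < y := hxpos.trans_le hxy
  have hLy : L ≤ Real.log (Real.log y) :=
    Real.log_le_log h𝓛pos (Real.log_le_log hxpos hxy)
  -- the character sums at `y`; the reference size `Q = x 𝓛^{Re z−1}` and the constant `P`
  set Q : ℝ := (x : ℝ) * 𝓛 ^ (z.re - 1) with hQdef
  set P : ℝ := Real.exp ((A₁ + Real.log κ + (2 * b.natAbs + 2)) * R ^ (3 / 2 : ℝ)) with hPdef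
  set M : ℝ := (y : ℝ) * Real.log y ^ (z.re - 1) * Real.exp (A₁ * R ^ (3 / 2 : ℝ)) with hMdef
  have hM0 : 0 ≤ M := by
    have : 0 ≤ Real.log (y : ℝ) := Real.log_nonneg (by exact_mod_cast (show 1 ≤ y by omega))
    positivity
  have hAχy : ∀ χ : DirichletCharacter ℂ q,
      ‖∑ n ∈ Finset.Ioc 0 y, χ (n : ZMod q) * z ^ (n.factorization.sum fun _ v => min v 2)‖ ≤ M := by
    intro χ
    have hyy : yχ χ ≤ y := (hY χ).trans (hxY.trans hxyN)
    have hRχ : 1 + ‖z - 1‖ ≤ Real.log (Real.log y) / Cχ χ := by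
      -- `1 + r ≤ 1 + L/C ≤ L/(2Cχ) + L/(2Cχ) = L/Cχ ≤ log log y / Cχ`
      have hc := hCχ χ
      have h1 : L / C ≤ L / (2 * Cχ χ) :=
        div_le_div_of_nonneg_left hL0.le (by positivity) ((by linarith only [hC₀ χ, hCC₀]) : 2 * Cχ χ ≤ C)
      have h2 : 1 ≤ L / (2 * Cχ χ) := by
        rw [le_div_iff₀ (by positivity)]; linarith only [hC₀ χ, hCC₀, hCL]
      have h3 : L / (2 * Cχ χ) + L / (2 * Cχ χ) = L / Cχ χ := by field_simp; ring
      have h4 : L / Cχ χ ≤ Real.log (Real.log y) / Cχ χ := div_le_div_of_nonneg_right hLy hc.le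
      rw [← hrdef]; linarith only [hrLC, h1, h2, h3, h4]
    refine (hyχ χ y hyy z hRχ).trans ?_
    rw [hMdef, ← hrdef, ← hRdef]
    have : 0 ≤ (y : ℝ) * Real.log y ^ (z.re - 1) := by
      have : 0 ≤ Real.log (y : ℝ) := Real.log_nonneg (by exact_mod_cast (show 1 ≤ y by omega))
      positivity
    refine mul_le_mul_of_nonneg_left (Real.exp_le_exp.2 ?_) this
    exact mul_le_mul_of_nonneg_right (hA₁ χ) (by positivity)
  -- the progression sum via orthogonality: `‖U‖ ≤ nχ · M`
  have hU : ‖∑ m ∈ (Finset.Ioc 0 y).filter (fun m : ℕ => ((m : ℤ) : ZMod q) = β),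
      z ^ (m.factorization.sum fun _ v => min v 2)‖ ≤ nχ * M :=
    norm_progression_sum_le hβ y z hAχy
  -- the reindexing and the boundary terms
  have hre := stub_apTiltedReindex a b x z ha
  have hN₀ := card_filter_nonpos_le a b x ha
  have hB₁ := norm_boundary_sum_le (a := a) (b := b) (y := y) hR1 hzR
  have hT : ‖∑ n ∈ Finset.range (x + 1),
      z ^ (((a * (n : ℤ) + b).toNat).factorization.sum fun _ v => min v 2)‖ ≤
      (2 * (b.natAbs : ℝ) + 1) * R ^ (2 * b.natAbs + 2) + nχ * M := by
    have hRpow : (1 : ℝ) ≤ R ^ (2 * b.natAbs + 2) := one_le_pow₀ hR1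
    have e1 : ‖((((Finset.range (x + 1)).filter fun n : ℕ => a * (n : ℤ) + b ≤ 0).card : ℕ) : ℂ)‖ ≤
        (b.natAbs : ℝ) + 1 := by
      rw [Complex.norm_natCast]; exact_mod_cast hN₀
    rw [hre]
    exact (norm_sub_le _ _).trans ((add_le_add (norm_add_le _ _) le_rfl).trans
      (boundary_bookkeeping hRpow e1 hU hB₁ (Nat.cast_nonneg _)))
  -- sizes: `x (log x)^{Re z−1} ≥ 1`, `(log y)^{Re z−1} ≤ (log x)^{Re z−1} e^{r log κ}`, `R^n ≤ e^{nR^{3/2}}`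
  have hbig : 1 ≤ (x : ℝ) * 𝓛 ^ (z.re - 1) := one_le_mul_log_rpow hxpos h𝓛pos hLdef hL0.le hrL2 hrez'
  have hlogy : Real.log (y : ℝ) ^ (z.re - 1) ≤ 𝓛 ^ (z.re - 1) * Real.exp (r * Real.log κ) :=
    log_rpow_le_of_le_mul hxpos h𝓛1 hxy hyκ hκ1 hrez hrez'
  have hR32 : R ≤ R ^ (3 / 2 : ℝ) := Real.self_le_rpow_of_one_le hR1 (by norm_num)
  have hR32' : (1 : ℝ) ≤ R ^ (3 / 2 : ℝ) := hR1.trans hR32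
  have hRn : R ^ (2 * b.natAbs + 2) ≤ Real.exp ((2 * (b.natAbs : ℝ) + 2) * R ^ (3 / 2 : ℝ)) := by
    have h1 : R ^ (2 * b.natAbs + 2) ≤ Real.exp (((2 * b.natAbs + 2 : ℕ) : ℝ) * R) := by
      rw [Real.exp_nat_mul]
      exact pow_le_pow_left₀ hR0 (by linarith only [Real.add_one_le_exp R]) _
    have h2 : ((2 * b.natAbs + 2 : ℕ) : ℝ) * R ≤ (2 * (b.natAbs : ℝ) + 2) * R ^ (3 / 2 : ℝ) := by
      have e : ((2 * b.natAbs + 2 : ℕ) : ℝ) = 2 * (b.natAbs : ℝ) + 2 := by push_cast; ring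
      have h0 : (0 : ℝ) ≤ 2 * (b.natAbs : ℝ) + 2 := by positivity
      rw [e]
      exact mul_le_mul_of_nonneg_left hR32 h0
    exact h1.trans (Real.exp_le_exp.2 h2)
  -- the two terms against `x 𝓛^{Re z−1} e^{(A − K₀) R^{3/2}}`
  have hQ1 : 1 ≤ Q := hbig
  have hQ0 : 0 ≤ Q := by linarith only [hQ1]
  have hterm1 : (2 * (b.natAbs : ℝ) + 1) * R ^ (2 * b.natAbs + 2) ≤ (2 * (b.natAbs : ℝ) + 1) * (Q * P) := by
    refine mul_le_mul_of_nonneg_left ?_ (by positivity)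
    calc R ^ (2 * b.natAbs + 2) ≤ Real.exp ((2 * (b.natAbs : ℝ) + 2) * R ^ (3 / 2 : ℝ)) := hRn
      _ ≤ P := by
          rw [hPdef, Real.exp_le_exp]
          have e1 : 0 ≤ A₁ * R ^ (3 / 2 : ℝ) := by positivity
          have e2 : 0 ≤ Real.log κ * R ^ (3 / 2 : ℝ) := by positivity
          have e : (A₁ + Real.log κ + (2 * b.natAbs + 2)) * R ^ (3 / 2 : ℝ) =
              A₁ * R ^ (3 / 2 : ℝ) + Real.log κ * R ^ (3 / 2 : ℝ) +
                (2 * (b.natAbs : ℝ) + 2) * R ^ (3 / 2 : ℝ) := by ring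
          rw [e]; linarith only [e1, e2]
      _ = 1 * P := (one_mul _).symm
      _ ≤ Q * P := mul_le_mul_of_nonneg_right hQ1 (Real.exp_pos _).le
  have hterm2 : nχ * M ≤ nχ * κ * (Q * P) := by
    have hly : 0 ≤ Real.log (y : ℝ) ^ (z.re - 1) :=
      Real.rpow_nonneg (Real.log_nonneg (by exact_mod_cast (show 1 ≤ y by omega))) _
    have h1 : M ≤ κ * (Q * P) :=
      size_conversion hxpos.le hyκ hκ1 (Real.rpow_nonneg h𝓛pos.le _) hlogy hly
        (hrR.trans hR32) (by positivity) (by positivity)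
    calc nχ * M ≤ nχ * (κ * (Q * P)) := mul_le_mul_of_nonneg_left h1 (by positivity)
      _ = nχ * κ * (Q * P) := by ring
  -- conclusion
  have hfinal : (2 * (b.natAbs : ℝ) + 1) * R ^ (2 * b.natAbs + 2) + nχ * M ≤
      ((x : ℝ) + 1) * Real.exp (Real.log (Real.log x) * (z.re - 1) + A * (1 + r) ^ (3 / 2 : ℝ)) := by
    have hpow : 𝓛 ^ (z.re - 1) = Real.exp (L * (z.re - 1)) := by
      rw [Real.rpow_def_of_pos h𝓛pos, hLdef]
    have h1 : (2 * (b.natAbs : ℝ) + 1) * R ^ (2 * b.natAbs + 2) + nχ * M ≤ K₀ * (Q * P) := by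
      rw [hK₀def]
      have e : (2 * (b.natAbs : ℝ) + 1 + nχ * κ) * (Q * P) =
          (2 * (b.natAbs : ℝ) + 1) * (Q * P) + nχ * κ * (Q * P) := by ring
      rw [e]; exact add_le_add hterm1 hterm2
    have h2 : K₀ * P ≤ Real.exp (A * R ^ (3 / 2 : ℝ)) := by
      have hK₀e : K₀ ≤ Real.exp (K₀ * R ^ (3 / 2 : ℝ)) := by
        have h1 : K₀ ≤ K₀ * R ^ (3 / 2 : ℝ) := le_mul_of_one_le_right (by linarith only [hK₀1]) hR32'
        linarith only [h1, Real.add_one_le_exp (K₀ * R ^ (3 / 2 : ℝ))]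
      calc K₀ * P ≤ Real.exp (K₀ * R ^ (3 / 2 : ℝ)) * P :=
            mul_le_mul_of_nonneg_right hK₀e (Real.exp_pos _).le
        _ = Real.exp (A * R ^ (3 / 2 : ℝ)) := by rw [hPdef, ← Real.exp_add, hAdef]; ring_nf
    calc (2 * (b.natAbs : ℝ) + 1) * R ^ (2 * b.natAbs + 2) + nχ * M ≤ K₀ * (Q * P) := h1
      _ = Q * (K₀ * P) := by ring
      _ ≤ Q * Real.exp (A * R ^ (3 / 2 : ℝ)) := mul_le_mul_of_nonneg_left h2 hQ0
      _ ≤ ((x : ℝ) + 1) * 𝓛 ^ (z.re - 1) * Real.exp (A * R ^ (3 / 2 : ℝ)) := by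
          rw [hQdef]
          have h𝓛z : 0 ≤ 𝓛 ^ (z.re - 1) := Real.rpow_nonneg h𝓛pos.le _
          exact mul_le_mul_of_nonneg_right (mul_le_mul_of_nonneg_right (by linarith only []) h𝓛z)
            (Real.exp_pos _).le
      _ = ((x : ℝ) + 1) * Real.exp (Real.log (Real.log x) * (z.re - 1) + A * (1 + r) ^ (3 / 2 : ℝ)) := by
          rw [Real.exp_add, hpow, hRdef]; ring
  exact hT.trans hfinal

end Summit.Parity.BatemanHorn.Cruxes.SystemZeroRepulsion.NearFar

end
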